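import Summits.QuantumFields.YangMills.Theorems.IR.ShellMaxCorrCofinalEngine
import Summits.QuantumFields.YangMills.Theorems.IR.CollarDecouplingCriterion
import Summits.QuantumFields.YangMills.Theorems.IR.ShellMaxCorrRung
import Summits.QuantumFields.YangMills.Theorems.IR.CollarDecouplingRungSC
import HarnessLib

/-!
# Crux `IR` RE-TYPED: leaf `IRcof` (stmt-QuantumFields-26930; supplier item `IR` stmt-QuantumFields-19354) — the merged line
«maximal correlation at one physical thickness» (`shell-maxcorr-doubling` + `collar-decoupling`), COFINAL RE-CUT

Lead prover ym-ir-line-mxc-p1 g5 (2026-08-28), answering director-ym №25 (2) (RE-PRICE every line against the re-typed leaf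
`Summit.QuantumFields.YangMills.Theses.BalabanLadder.IRcof` = the `GapInUnits` family owed only on SOME set of couplings
unbounded above; 21-frontier approval of R423, route rev 12).  Companion of the skeleton of record for the old leaf,
`Lines/shell_maxcorr_doubling.lean` v7 (concludes `Theses.BalabanLadder.IR` from the load of record `stub_shellCert : IRShellCorr`).
NOT a registry write (slot of record on 19354/26930 = LEAD ym-ir-line-ab-p1, g9-№1 / №27 (2)); published with `crux write`.

RE-PRICED: **WALL UNCHANGED.**  The line's only open statement was and is its XL load — a shell maximal-correlation certificate
`Ψ_β(⌈K₀/a(β)⌉) ≤ θ < 1` AT a large coupling, uniformly in the inner radius and the volume (EQUIV-or-stronger than the leaf at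
each certified coupling; simplicity of `G` load-bearing; no mechanism located — ideator ym-ir-idea-1 g2–g8, census §L row 4).
The quantifier «for all large β» was never the difficulty, and the ENGINE IS PER-COUPLING (tree
`ShellMaxCorr.abs_latticeConnectedCorr_le_exp_of_shellCert`, p618715): so under the re-typing the load drops to its COFINAL form
`IRShellCorrCof` below («`LowerBounds` ⇒ on SOME set of couplings unbounded above, the certificate at one physical thickness on all
large tori») and the line closes `IRcof` modulo that ONE stub, by name (`IRcof_of`).  Everything else is a tree theorem:
engine on a coupling set `gapOn_of_shellCertOn`, collar-on-`Bset` ⇒ shell-on-`Bset` `shellCertOn_of_collarOnsetOn`, compositions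
`ircof_of_shellCertCof` / `ircof_of_collarOnsetCof`, comparison `shellCertCof_of_irShellCorr` (all p618715,
`Theorems/IR/ShellMaxCorrCofinalEngine.lean`); engine `stub_shellEngine` p589320, rung `stub_shellRung` p596102, collar E-seam
`stub_collarCriterion` p590240, collar rung `stub_collarRungSC` p610100, tensorisation T1 p616789 (unchanged, imported / cited).
The collar typing's load re-cuts the same way (`CollarDecoupling.CollarOnsetCof`, §2) and implies the shell cofinal load
(`irShellCorrCof_of_collarOnsetCof`), so the merged line still has ONE load in two currencies, the shell one the weaker.

What the cofinal form buys THIS line: nothing mechanistic (honest) — the certificate at a single large coupling is the whole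
weak-coupling mass gap in maximal-correlation clothes; it only removes any need for β-UNIFORMITY / transport of the certificate's
constants `(K₀, θ, S₁)` along the coupling axis (they may now be chosen per certified coupling, provided ONE `(K₀, θ)` serves an
unbounded set — note the ∃∀ order: `K₀, θ` before `β ∈ Bset`; a per-coupling `θ(β) → 1` would NOT close `IRcof`).

HONEST FRAMING: CONDITIONAL rung line; the ONE `sorry` below is the XL load (NOT staffed, R366 (i)); `BalabanLadder.IRcof` /
`IR` NOT proved; the Clay YM mass gap NOT proved; R4 closes only the finite-𝕋⁴ UV rung `BalabanLadder.UV`.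
-/
set_option autoImplicit false

noncomputable section

open Filter Topology MeasureTheory
open Literature.MathematicalPhysics.QuantumFieldTheory Literature.MathematicalPhysics.QuantumLattice
open Summit.QuantumFields.YangMills.Cruxes.OSLegsFromFemtoAndGap.DlrCollarTransfer (GapInUnits LowerBounds)

/-! ## §1 The cofinal shell load and the composition to `IRcof` -/

namespace Summit.QuantumFields.YangMills.Cruxes.IR.ShellMaxCorr

/-- **THE COFINAL LOAD (XL — NOT staffed).**  For compact SIMPLE `G`, non-triviality in units `a` (`LowerBounds`) forces a set of
couplings `Bset` UNBOUNDED ABOVE and ONE physical thickness `K₀` with ONE constant `θ < 1` such that for the couplings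
`β ∈ Bset`, `β ≥ β₂`, and all tori `S ≥ S₁ β`, the shell maximal correlation at lattice thickness `⌈K₀/a β⌉` is `≤ θ` for every
inner radius (`ShellCert`).  `Bset = univ` is the load of record `IRShellCorr`; this is the hypothesis of the tree composition
`ircof_of_shellCertCof`, verbatim. -/
def IRShellCorrCof : Prop :=
  ∀ (G : Type) [Group G] [TopologicalSpace G] [IsTopologicalGroup G] [CompactSpace G],
    IsCompactSimpleLieGroup G → letI : MeasurableSpace G := borel G; haveI : BorelSpace G := ⟨rfl⟩;
    ∀ (r : LatticeRep G) (a : ℝ → ℝ), (∀ β, 0 < a β) → Tendsto a atTop (𝓝 0) → LowerBounds G r a →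
      ∃ Bset : Set ℝ, (∀ x : ℝ, ∃ β ∈ Bset, x ≤ β) ∧
        ∃ (K₀ θ β₂ : ℝ) (S₁ : ℝ → ℕ), 0 < K₀ ∧ 0 ≤ θ ∧ θ < 1 ∧
          ∀ β ∈ Bset, β₂ ≤ β → ∀ S : ℕ, S₁ β ≤ S → ShellCert r.ρ β S ⌈K₀ / a β⌉₊ θ

/-- STUB — THE COFINAL LOAD (XL; the ONLY `sorry` of this skeleton; NOT staffed per R366 (i)). -/
theorem stub_shellCertCof : IRShellCorrCof := by
  sorry

/-- The load of record implies the cofinal load (tree `shellCertCof_of_irShellCorr`, `Bset = univ`). -/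
theorem irShellCorrCof_of_irShellCorr (hC : IRShellCorr) : IRShellCorrCof :=
  shellCertCof_of_irShellCorr hC

-- the landed stubs of the merged line (unchanged by the re-typing), cited by name
example : ShellEngine := stub_shellEngine
example : ShellRung := stub_shellRung
example : CollarDecoupling.CollarCriterion := CollarDecoupling.stub_collarCriterion
example : CollarDecoupling.CollarRungSC := CollarDecoupling.stub_collarRungSC

/-- **The merged line concludes the RE-TYPED route decl BY NAME:** cofinal load + engine on its coupling set ⇒ `IRcof`
(tree `ircof_of_shellCertCof`, whose engine half `gapOn_of_shellCertOn` is proved). -/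
theorem IRcof_of : Summit.QuantumFields.YangMills.Theses.BalabanLadder.IRcof :=
  ircof_of_shellCertCof stub_shellCertCof

end Summit.QuantumFields.YangMills.Cruxes.IR.ShellMaxCorr

/-! ## §2 The collar typing's load, re-cut the same way (second currency of the merged line) -/

namespace Summit.QuantumFields.YangMills.Cruxes.IR.CollarDecoupling

/-- **Cofinal collar onset (XL; NOT a separate stub — it implies `IRShellCorrCof`).**  For compact SIMPLE `G`, `LowerBounds`
gives a set of couplings UNBOUNDED ABOVE on which, beyond `β₂`, the collar format `CollarDecouplingAt r.ρ β b` holds at some mesh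
`b ≥ 1` of bounded physical width `a β · b < T`.  `Bset = univ` is `CollarSharpOnset` of `Lines/collar_decoupling.lean`. -/
def CollarOnsetCof : Prop :=
  ∀ (G : Type) [Group G] [TopologicalSpace G] [IsTopologicalGroup G] [CompactSpace G],
    IsCompactSimpleLieGroup G → letI : MeasurableSpace G := borel G; haveI : BorelSpace G := ⟨rfl⟩;
    ∀ (r : LatticeRep G) (a : ℝ → ℝ), (∀ β, 0 < a β) → Tendsto a atTop (𝓝 0) → LowerBounds G r a →
      ∃ Bset : Set ℝ, (∀ x : ℝ, ∃ β ∈ Bset, x ≤ β) ∧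
        ∃ T β₂ : ℝ, ∀ β ∈ Bset, β₂ ≤ β → ∃ b : ℕ, 1 ≤ b ∧ a β * (b : ℝ) < T ∧ CollarDecouplingAt r.ρ β b

/-- The cofinal collar load implies the cofinal shell load (tree `shellCertOn_of_collarOnsetOn`, per coupling). -/
theorem irShellCorrCof_of_collarOnsetCof (h : CollarOnsetCof) : ShellMaxCorr.IRShellCorrCof := by
  intro G _ _ _ _ hG
  letI : MeasurableSpace G := borel G
  haveI : BorelSpace G := ⟨rfl⟩
  intro r a ha ha0 hlb
  obtain ⟨Bset, hcof, hT⟩ := h G hG r a ha ha0 hlb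
  exact ⟨Bset, hcof, ShellMaxCorr.shellCertOn_of_collarOnsetOn r a ha ha0 Bset hT⟩

/-- The collar currency closes the re-typed leaf too (tree `ircof_of_collarOnsetCof`), in hypotheses form — no second `sorry`. -/
theorem IRcof_of_collar (h : CollarOnsetCof) : Summit.QuantumFields.YangMills.Theses.BalabanLadder.IRcof :=
  ShellMaxCorr.ircof_of_collarOnsetCof h

end Summit.QuantumFields.YangMills.Cruxes.IR.CollarDecoupling

end
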